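import Summits.BirchSwinnertonDyer.BirchSwinnertonDyer.Theorems.CMKolyvaginAtInertTwoGenusDefectShaLaddersOfSuppliesAtTwo
import Summits.BirchSwinnertonDyer.BirchSwinnertonDyer.Theorems.CMKolyvaginAtInertTwoLowerCapstoneAtTwo
import Summits.BirchSwinnertonDyer.BirchSwinnertonDyer.Theorems.GenusKolyvaginAtTwoEquivariantKolyvaginExactAtTwoArchimedeanSelmerLevel
import HarnessLib

/-!
# Route `CMKolyvaginAtInertTwo`, crux `CMKolyvaginExactAtInertTwo` (stmt-BirchSwinnertonDyer-24277) —
# Ш(·/ℚ)-VALUED CAPSTONE: the two ladders in `Ш(W/ℚ)`, `Ш(W^{(d_K)}/ℚ)` from Kolyvagin's depth supplies (KS)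

Seat `bsd-line-cmk2-p1` g20 (cell `bsd-print-cf2`), `--supports stmt-BirchSwinnertonDyer-24277` (helper; closes nothing).
THEOREMS ONLY (no definition, no named fact, no `sorry`).  BSD is NOT proved by this.

Step (d) of the threading of memo `MEMO-genus-triviality.md` §6.2: g19's capstone′
(`KolyvaginLowerTwo.twinShaLadders_of_kolyvaginSuppliesAtTwo'`) re-threaded through the double-clause chain.  The supplied class of
McCallum's Prop. 5.2 at `2` is `y = 2^{L−M′}·c_L(n)` with `M′ ≤ M₀ < L`, so `y = 2·y'` with `y' = 2^{L−M′−1}·c_L(n)` an eigenclass of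
the same sign (`conjAct_zsmul_kolyvaginClass_two`) which is Selmer at every place `w` of `K` over `d_K` (Gross 6.2 (1): the primes of `n`
are Kolyvagin primes, prime to `d_K`, so `w ∤ n`).  Hence the DOUBLE CLAUSE holds for free, and the ladders land in `Ш(W/ℚ)` and
`Ш(W^{(d_K)}/ℚ)` (`twinShaLaddersQ_of_depth_supplies_of_double`).

* §1 `natCast_not_mem_asIdeal_of_discr_mem` (a place over `d_K` is prime to a product of Kolyvagin primes),
  `avoidance_of_kolyvaginSupply_intrinsic_of_double` (g19's avoidance binder with the double clause);
* §2 `twinShaLaddersQ_of_kolyvaginSuppliesAtTwo_of_double` — the Ш(·/ℚ)-valued capstone modulo (KS) and `rank E(K) = 1`, (R0)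
  discharged by gk2-p2's `rankZero_side_of_rootNumber`.

References: [McCallumLMS1991] §5 Prop. 5.2, Thm. 5.4 (p. 310); [GrossLMS1991] Thm. 1.3, §5 (5.1), Prop. 5.3, Prop. 5.4, Prop. 6.2;
[DokchitserDokchitserAnnals2010] Lemma 4.14.
-/

set_option autoImplicit false
-- the Theorems namespace of this sub repeats the summit name by design (D-0017 nested layout)
set_option linter.dupNamespace false

noncomputable section

open scoped Classical

namespace Summit.BirchSwinnertonDyer.BirchSwinnertonDyer.Theorems.KolyvaginGenusTwo

open WeierstrassCurve NumberField IsDedekindDomain Field Rat.HeightOneSpectrum AddSubgroup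
open Literature.NumberTheory.EllipticCurves Literature.NumberTheory.GaloisRepresentations
open Literature.NumberTheory.EllipticCurves.ModularForms
open Literature.NumberTheory.EllipticCurves.GrossLMS1991 (prop37_2_reductionCongruence_inert)
open Summit.BirchSwinnertonDyer.BirchSwinnertonDyer.Theorems.GenusExact
open Summit.BirchSwinnertonDyer.BirchSwinnertonDyer.Theorems.GenusExact.PlusDescent
open Summit.BirchSwinnertonDyer.Rank1Residual

variable {K : Type} [Field K] [NumberField K]

/-! ## §1 The double clause for Kolyvagin's supplied classes -/

/-- **A place of `K` over `d_K` is prime to a square-free product `n` of Kolyvagin primes** (`ℓ ∤ d_K` for a Kolyvagin prime `ℓ`, so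
`(ℓ, d_K) = 1` in `w`). [cite: WZhang2014, Notations (xii)] [cite: GrossLMS1991, §3 (3.1)] -/
theorem natCast_not_mem_asIdeal_of_discr_mem {N : ℕ} {W : WeierstrassCurve ℚ} [W.IsGloballyMinimal] {p n : ℕ} (hn0 : n ≠ 0)
    (hKol : ∀ ℓ ∈ n.primeFactors, Zhang2014.IsKolyvaginPrime N W K p ℓ)
    (w : HeightOneSpectrum (𝓞 K)) (hw : ((NumberField.discr K : ℤ) : 𝓞 K) ∈ w.asIdeal) :
    ((n : ℕ) : 𝓞 K) ∉ w.asIdeal := by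
  intro h
  obtain ⟨ℓ, hℓ, hℓw⟩ := (JET.SelmerVocabulary.natCast_mem_iff_exists_primeFactor_mem (K := K) hn0 w).mp h
  have hℓp : ℓ.Prime := Nat.prime_of_mem_primeFactors hℓ
  have hnd : ¬ ((ℓ : ℤ) ∣ NumberField.discr K) := (hKol ℓ hℓ).2.2.1
  obtain ⟨a, b, hab⟩ := (Nat.prime_iff_prime_int.mp hℓp).irreducible.coprime_iff_not_dvd.mpr hnd
  have h1 : (1 : 𝓞 K) ∈ w.asIdeal := by
    have hab' := congrArg (Int.cast : ℤ → 𝓞 K) hab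
    push_cast at hab'
    rw [← hab']
    exact add_mem (Ideal.mul_mem_left _ _ hℓw) (Ideal.mul_mem_left _ _ hw)
  exact w.isPrime.ne_top ((Ideal.eq_top_iff_one _).mpr h1)

variable (W : WeierstrassCurve ℚ) [W.IsElliptic] [W.IsGloballyMinimal] [NeZero (W.conductorNorm ℤ)]
  (Dt : ModularParametrizationData W (W.conductorNorm ℤ)) (β : ℤ) (ι : K →+* ℂ) (τ : K ≃ₐ[ℚ] K) (L : ℕ)

/-- **PROP. 5.2 AT `2`, INTRINSIC AVOIDANCE FORM ⟹ the avoidance binder WITH THE DOUBLE CLAUSE** (sign `ε`, seed `C₀`,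
`(s, a) = (b+1, M'−k)`, one spare level `M' + 1 ≤ L`): g19's `KolyvaginLowerTwo.avoidance_of_kolyvaginSupply_intrinsic`, the supplied
class `y = 2^{L−M'}·c_L(n)` recorded together with `y' = 2^{L−M'−1}·c_L(n)` — same sign (`conjAct_zsmul_kolyvaginClass_two`), Selmer at
the places over `d_K` (Gross 6.2 (1), `natCast_not_mem_asIdeal_of_discr_mem`).
[cite: McCallumLMS1991, §5 Prop. 5.2, p. 285] [cite: GrossLMS1991, Prop. 5.4, Prop. 6.2] -/
theorem avoidance_of_kolyvaginSupply_intrinsic_of_double (hρ2 : W.HasSurjectiveModNGaloisRep 2)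
    (hK : IsImaginaryQuadratic K) (hne3 : NumberField.discr K ≠ -3) (hodd' : Odd (NumberField.discr K))
    (hH : SatisfiesHeegnerHypothesis (W.conductorNorm ℤ) K) (hodd : Odd W.tamagawaProduct)
    (h37 : prop37_2_reductionCongruence_inert (W.conductorNorm ℤ) W K) (hτ : τ ≠ 1)
    (ε : ℤ) {M' k b : ℕ} (hL : 1 ≤ L) (hkM : k ≤ M') (hML : M' + 1 ≤ L)
    (C₀ : AddSubgroup (galH1Torsion (W.baseChange K) ((2 ^ L : ℕ) : ℤ)))
    (hP52 : ∀ (i : ℕ) (u : Fin i → galH1Torsion (W.baseChange K) ((2 ^ L : ℕ) : ℤ)), i ≤ b →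
      (∀ j, u j ∈ selmerGroup (W.baseChange K) ((2 ^ L : ℕ) : ℤ) ∧ conjAct W τ ((2 ^ L : ℕ) : ℤ) (u j) = ε • u j) →
      ∃ (n : ℕ) (_ : Squarefree n)
        (_ : ∀ ℓ ∈ n.primeFactors, Zhang2014.IsKolyvaginPrime (W.conductorNorm ℤ) W K 2 ℓ ∧ L ≤ Zhang2014.kolyvaginIndex W 2 ℓ)
        (d : KolyvaginHeegnerData Dt β ι n),
        (∀ ℓ ∈ n.primeFactors, ∀ e : KolyvaginHeegnerData Dt β ι (n / ℓ),
          ((2 ^ (L - M') : ℕ) : ℤ) • e.kolyvaginClass Nat.prime_two L = 0) ∧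
        addOrderOf (d.kolyvaginClass Nat.prime_two L) = 2 ^ (L - k) ∧
        -W.rootNumber * (-1) ^ n.primeFactors.card = ε ∧
        Disjoint (zmultiples (((2 ^ (L - M') : ℕ) : ℤ) • d.kolyvaginClass Nat.prime_two L))
          (AddSubgroup.closure (Set.range u) ⊔ C₀)) :
    ∀ i < b + 1, ∀ u : Fin i → galH1Torsion (W.baseChange K) ((2 ^ L : ℕ) : ℤ),
      (∀ j, (u j ∈ selmerGroup (W.baseChange K) ((2 ^ L : ℕ) : ℤ) ∧ conjAct W τ ((2 ^ L : ℕ) : ℤ) (u j) = ε • u j) ∧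
        ∃ u' : galH1Torsion (W.baseChange K) ((2 ^ L : ℕ) : ℤ), u j = 2 • u' ∧ conjAct W τ ((2 ^ L : ℕ) : ℤ) u' = ε • u' ∧
          ∀ w : HeightOneSpectrum (𝓞 K), ((NumberField.discr K : ℤ) : 𝓞 K) ∈ w.asIdeal →
            u' ∈ selmerLocalKer (W.baseChange K) (w.adicCompletion K) ((2 ^ L : ℕ) : ℤ)) →
      (∀ j, addOrderOf (u j) = 2 ^ (M' - k)) →
      ∃ y : galH1Torsion (W.baseChange K) ((2 ^ L : ℕ) : ℤ),
        ((y ∈ selmerGroup (W.baseChange K) ((2 ^ L : ℕ) : ℤ) ∧ conjAct W τ ((2 ^ L : ℕ) : ℤ) y = ε • y) ∧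
          ∃ y' : galH1Torsion (W.baseChange K) ((2 ^ L : ℕ) : ℤ), y = 2 • y' ∧ conjAct W τ ((2 ^ L : ℕ) : ℤ) y' = ε • y' ∧
            ∀ w : HeightOneSpectrum (𝓞 K), ((NumberField.discr K : ℤ) : 𝓞 K) ∈ w.asIdeal →
              y' ∈ selmerLocalKer (W.baseChange K) (w.adicCompletion K) ((2 ^ L : ℕ) : ℤ)) ∧
        addOrderOf y = 2 ^ (M' - k) ∧ Disjoint (zmultiples y) (AddSubgroup.closure (Set.range u) ⊔ C₀) := by
  have hne4 : NumberField.discr K ≠ -4 := fun h ↦ by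
    rw [h] at hodd'
    exact (Int.not_even_iff_odd.mpr hodd') ⟨-2, by norm_num⟩
  have hsurj1 : W.HasSurjectiveModNGaloisRep ((2 : ℤ) ^ 1) := by simpa using hρ2
  intro i hi u hu _
  obtain ⟨n, hn, hKol, d, hsub, hordc, hsign, hdisj⟩ := hP52 i u (Nat.lt_succ_iff.mp hi) (fun j ↦ (hu j).1)
  have hn0 : n ≠ 0 := hn.ne_zero
  refine ⟨((2 ^ (L - M') : ℕ) : ℤ) • d.kolyvaginClass Nat.prime_two L,
    ⟨⟨?_, ?_⟩, ((2 ^ (L - M' - 1) : ℕ) : ℤ) • d.kolyvaginClass Nat.prime_two L, ?_, ?_, fun w hw ↦ ?_⟩, ?_, hdisj⟩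
  · exact KolyvaginLowerTwo.zsmul_kolyvaginClass_two_mem_selmerGroup_of_forall W Dt β ι hρ2 hK hne3 hne4 hH hodd h37 L (L - M') hn
      hKol d hsub
  · rw [PlusDescent.conjAct_zsmul_kolyvaginClass_two W Dt β ι hK hne3 hne4 hodd' hH hsurj1 τ hτ hn hL hKol d (L - M'), hsign]
  · rw [← natCast_zsmul, smul_smul]
    congr 1
    obtain ⟨j, hj⟩ : ∃ j, L - M' = j + 1 := ⟨L - M' - 1, by omega⟩
    rw [hj, Nat.add_sub_cancel]
    push_cast
    ring
  · rw [PlusDescent.conjAct_zsmul_kolyvaginClass_two W Dt β ι hK hne3 hne4 hodd' hH hsurj1 τ hτ hn hL hKol d (L - M' - 1), hsign]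
  · exact AddSubgroup.zsmul_mem _ (P2.TamagawaSelmerAtTwo.kolyvaginClass_mem_selmerLocalKer_two_pow_of_not_mem d hK hH hodd hn0 L w
      (natCast_not_mem_asIdeal_of_discr_mem hn0 (fun ℓ hℓ ↦ (hKol ℓ hℓ).1) w hw)) _
  · exact PlusDescent.addOrderOf_zsmul_kolyvaginClass_two W Dt β ι d hkM (by omega) hordc

/-! ## §2 The Ш(·/ℚ)-valued capstone modulo (KS) and `rank E(K) = 1` -/

/-- **THE TWO `Ш(·/ℚ)`-VALUED LADDERS MODULO (KS) AND `rank E(K) = 1`** (twin in the model `W.quadraticTwist d_K`): g19's capstone′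
`KolyvaginLowerTwo.twinShaLadders_of_kolyvaginSuppliesAtTwo'` ((R0) discharged by `rankZero_side_of_rootNumber`, the K-side frame by
`exists_Kside_frame`) re-threaded through `avoidance_of_kolyvaginSupply_intrinsic_of_double` and `twinShaLaddersQ_of_depth_supplies_of_double`,
with `Δ_W < 0` (empty real Selmer conditions of `W` and `W^{(d_K)}`) and (desc-fin) off `d_K` for both curves (`hdescfin_of_not_dvd_discr`,
`hdescfin_twist_of_not_dvd_discr`).  Hypotheses: `ρ̄_{E,2}` onto, `Odd ∏ c_p`, `K` imaginary quadratic with odd `d_K ≠ −3`, Heegner,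
Gross 3.7 (2) at `(W, K)`, `y_K` non-torsion, `rank E(K) = 1`, `2^{M₀+1} ∤ P(1)`, and the depth supplies (KS) at a level `L ≥ M₀ + 1`.
[cite: McCallumLMS1991, §5 Prop. 5.2, Thm. 5.4 (p. 310)] [cite: GrossLMS1991, Thm. 1.3, §5 (5.1), Prop. 5.3, Prop. 5.4, Prop. 6.2]
[cite: DokchitserDokchitserAnnals2010, Lemma 4.14 (proof)] -/
theorem twinShaLaddersQ_of_kolyvaginSuppliesAtTwo_of_double (hρ2 : W.HasSurjectiveModNGaloisRep 2)
    (hT : Odd W.tamagawaProduct) (hΔ : W.Δ < 0) (hIQ : IsImaginaryQuadratic K)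
    (hodd : Odd (NumberField.discr K)) (h3 : NumberField.discr K ≠ -3) (hHe : SatisfiesHeegnerHypothesis (W.conductorNorm ℤ) K)
    (h37 : prop37_2_reductionCongruence_inert (W.conductorNorm ℤ) W K)
    (d₁ : KolyvaginHeegnerData Dt β ι 1)
    (hy : ¬ IsOfFinAddOrder d₁.derivedPoint) (hrk1 : (W.baseChange K).mordellWeilRank = 1) (M₀ : ℕ)
    (hndiv : ¬ ∃ Q : (W.baseChange (ringClassField K ι 1)).toAffine.Point, ((2 ^ (M₀ + 1) : ℕ) : ℤ) • Q = d₁.derivedPoint)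
    [(W.quadraticTwist (NumberField.discr K : ℚ)).IsElliptic]
    (hKS : ∀ τ : K ≃ₐ[ℚ] K, τ ≠ 1 → ∃ (L R : ℕ) (Mr : ℕ → ℕ), M₀ + 1 ≤ L ∧ (∀ j, Mr (j + 1) ≤ Mr j) ∧ Mr 0 = M₀ ∧ Mr R = 0 ∧
      (∀ m : ℕ, Mr (2 * m + 1) < Mr (2 * m) →
        ∀ (i : ℕ) (u : Fin i → galH1Torsion (W.baseChange K) ((2 ^ L : ℕ) : ℤ)), i ≤ 2 * m + 1 →
        (∀ j, u j ∈ selmerGroup (W.baseChange K) ((2 ^ L : ℕ) : ℤ) ∧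
          conjAct W τ ((2 ^ L : ℕ) : ℤ) (u j) = W.rootNumber • u j) →
        ∃ (n : ℕ) (_ : Squarefree n)
          (_ : ∀ ℓ ∈ n.primeFactors, Zhang2014.IsKolyvaginPrime (W.conductorNorm ℤ) W K 2 ℓ ∧ L ≤ Zhang2014.kolyvaginIndex W 2 ℓ)
          (d : KolyvaginHeegnerData Dt β ι n),
          (∀ ℓ ∈ n.primeFactors, ∀ e : KolyvaginHeegnerData Dt β ι (n / ℓ),
            ((2 ^ (L - Mr (2 * m)) : ℕ) : ℤ) • e.kolyvaginClass Nat.prime_two L = 0) ∧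
          addOrderOf (d.kolyvaginClass Nat.prime_two L) = 2 ^ (L - Mr (2 * m + 1)) ∧
          -W.rootNumber * (-1) ^ n.primeFactors.card = W.rootNumber ∧
          Disjoint (zmultiples (((2 ^ (L - Mr (2 * m)) : ℕ) : ℤ) • d.kolyvaginClass Nat.prime_two L))
            (AddSubgroup.closure (Set.range u))) ∧
      (∀ m : ℕ, Mr (2 * m + 2) < Mr (2 * m + 1) →
        ∀ (i : ℕ) (u : Fin i → galH1Torsion (W.baseChange K) ((2 ^ L : ℕ) : ℤ)), i ≤ 2 * m + 1 →
        (∀ j, u j ∈ selmerGroup (W.baseChange K) ((2 ^ L : ℕ) : ℤ) ∧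
          conjAct W τ ((2 ^ L : ℕ) : ℤ) (u j) = (-W.rootNumber) • u j) →
        ∃ (n : ℕ) (_ : Squarefree n)
          (_ : ∀ ℓ ∈ n.primeFactors, Zhang2014.IsKolyvaginPrime (W.conductorNorm ℤ) W K 2 ℓ ∧ L ≤ Zhang2014.kolyvaginIndex W 2 ℓ)
          (d : KolyvaginHeegnerData Dt β ι n),
          (∀ ℓ ∈ n.primeFactors, ∀ e : KolyvaginHeegnerData Dt β ι (n / ℓ),
            ((2 ^ (L - Mr (2 * m + 1)) : ℕ) : ℤ) • e.kolyvaginClass Nat.prime_two L = 0) ∧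
          addOrderOf (d.kolyvaginClass Nat.prime_two L) = 2 ^ (L - Mr (2 * m + 2)) ∧
          -W.rootNumber * (-1) ^ n.primeFactors.card = -W.rootNumber ∧
          Disjoint (zmultiples (((2 ^ (L - Mr (2 * m + 1)) : ℕ) : ℤ) • d.kolyvaginClass Nat.prime_two L))
            (AddSubgroup.closure (Set.range u) ⊔ zmultiples (d₁.kolyvaginClass Nat.prime_two L)))) :
    ∃ (T : ℕ) (M : ℕ → ℕ), (∀ j, M (j + 1) ≤ M j) ∧ M 0 = M₀ ∧ M (2 * T) = 0 ∧
      (∀ m < T, ∃ x : Fin (2 * m + 2) → W.galH1, (∀ i, x i ∈ W.sha) ∧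
        (∀ i, addOrderOf (x i) = 2 ^ (M (2 * m) - M (2 * m + 1))) ∧
        ∀ c : Fin (2 * m + 2) → ℤ, ∑ i, c i • x i = 0 → ∀ i, ((2 ^ (M (2 * m) - M (2 * m + 1)) : ℕ) : ℤ) ∣ c i) ∧
      (∀ m < T, ∃ x : Fin (2 * m + 2) → (W.quadraticTwist (NumberField.discr K : ℚ)).galH1,
        (∀ i, x i ∈ (W.quadraticTwist (NumberField.discr K : ℚ)).sha) ∧
        (∀ i, addOrderOf (x i) = 2 ^ (M (2 * m + 1) - M (2 * m + 2))) ∧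
        ∀ c : Fin (2 * m + 2) → ℤ, ∑ i, c i • x i = 0 → ∀ i, ((2 ^ (M (2 * m + 1) - M (2 * m + 2)) : ℕ) : ℤ) ∣ c i) := by
  have h2 : Module.finrank ℚ K = 2 := hIQ.1
  have hD0 : (NumberField.discr K : ℚ) ≠ 0 := by exact_mod_cast NumberField.discr_ne_zero K
  -- (R0) from `rank E(K) = 1`, the Heegner point over `P(1)` and `ρ̄_{E,2}` onto
  obtain ⟨Ph, hPh, hPhmap⟩ := AdditiveKoly.exists_isHeegnerPoint_map_eq_derivedPoint_one (W := W) (K := K) (Dt := Dt) (β := β)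
    (ι := ι) hIQ hHe d₁
  have hnt : ¬ IsOfFinAddOrder Ph := fun h ↦ hy (by
    rw [← hPhmap]
    exact AddMonoidHom.isOfFinAddOrder _ h)
  have hR0 := rankZero_side_of_rootNumber K W hIQ hHe hρ2 hrk1 hPh hnt
    (Wd := W.quadraticTwist (NumberField.discr K : ℚ)) ⟨1, one_smul _ _⟩
  -- the conjugation of `K`
  obtain ⟨τ, -, hτ, -, -, -, -⟩ := exists_gal_ne_one_sqrt_discr (K := K) h2
  obtain ⟨L, R, Mr, hML, hMr, hMr0, hMrR, hOdd, hEven⟩ := hKS τ hτ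
  have hL1 : 1 ≤ L := by omega
  have hn : ((2 ^ L : ℕ) : ℤ) ≠ 0 := by positivity
  have hsurj1 : W.HasSurjectiveModNGaloisRep ((2 : ℤ) ^ 1) := by simpa using hρ2
  -- the frame at level `2^L`
  have hdiv : ∀ P : geomPoints (W.baseChange K), ∃ Q : geomPoints (W.baseChange K), ((2 ^ L : ℕ) : ℤ) • Q = P :=
    (W.baseChange K).zsmul_geomPoints_surjective_of_charZero hn
  obtain ⟨hL, g, P₀, hg, hP₀map, hP₀, hc1⟩ := exists_Kside_frame W Dt β ι hIQ hodd hHe hsurj1 hrk1.le d₁ hML hndiv hdiv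
  -- the antitone minima in the large
  have hanti : ∀ a b, a ≤ b → Mr b ≤ Mr a := fun a b hab ↦ by
    induction hab with
    | refl => exact le_rfl
    | step _ ih => exact (hMr _).trans ih
  have hMrL : ∀ j, Mr j + 1 ≤ L := fun j ↦ by
    have := hanti 0 j (Nat.zero_le j)
    omega
  -- (R0) in divisibility currency
  have hrank0 : (W.rootNumber = 1 ∧ ∀ P : W.toAffine.Point, ∃ Q : W.toAffine.Point, ((2 ^ L : ℕ) : ℤ) • Q = P) ∨
      (W.rootNumber = -1 ∧ ∀ P : (W.quadraticTwist (NumberField.discr K : ℚ)).toAffine.Point,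
        ∃ Q : (W.quadraticTwist (NumberField.discr K : ℚ)).toAffine.Point, ((2 ^ L : ℕ) : ℤ) • Q = P) := by
    rcases hR0 with ⟨hw, hrk, htor⟩ | ⟨hw, hrk, htor⟩
    · refine Or.inl ⟨hw, fun P ↦ ?_⟩
      convert exists_zsmul_two_pow_eq_of_rank_zero_of_odd_torsionOrder W hrk htor L P
    · refine Or.inr ⟨hw, fun P ↦ ?_⟩
      convert exists_zsmul_two_pow_eq_of_rank_zero_of_odd_torsionOrder (W.quadraticTwist (NumberField.discr K : ℚ)) hrk htor L P
  -- the local binders of the Ш-descent: empty real conditions (`Δ < 0`), (desc-fin) off `d_K`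
  have hinfW : ∀ v : InfinitePlace ℚ, selmerLocalKer W v.Completion ((2 ^ L : ℕ) : ℤ) = ⊤ := fun v ↦
    ArchVanishing.selmerLocalKer_infinitePlace_eq_top_of_Δ_neg W v hΔ _
  have hinfD : ∀ v : InfinitePlace ℚ,
      selmerLocalKer (W.quadraticTwist (NumberField.discr K : ℚ)) v.Completion ((2 ^ L : ℕ) : ℤ) = ⊤ := fun v ↦
    ArchVanishing.selmerLocalKer_infinitePlace_quadraticTwist_eq_top_of_Δ_neg W v hΔ hD0 _
  refine twinShaLaddersQ_of_depth_supplies_of_double W K h2 τ hτ L hdiv hL hinfW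
    (fun v ξ hnd hξ ↦ hdescfin_of_not_dvd_discr hIQ hHe _ ξ v hnd hξ) hinfD
    (fun v ξ hnd hξ ↦ hdescfin_twist_of_not_dvd_discr W hIQ hodd hHe _ ξ v hnd hξ) hrank0 g hg P₀ hP₀ M₀ R Mr hMr hMr0 hMrR
    (fun m hlt i hi u hu hord ↦ ?_) (fun m hlt i hi u hu hord ↦ ?_)
  · -- odd depth `2m+1`: sign `w(E)`, no seed
    have h := avoidance_of_kolyvaginSupply_intrinsic_of_double W Dt β ι τ L hρ2 hIQ h3 hodd hHe hT h37 hτ W.rootNumber hL1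
      (hMr (2 * m)) (hMrL (2 * m)) ⊥
      (fun i u hi hu ↦ by
        obtain ⟨n, hn', hKol, d, hsub, hordc, hsign, hdisj⟩ := hOdd m hlt i u hi hu
        exact ⟨n, hn', hKol, d, hsub, hordc, hsign, by rwa [sup_bot_eq]⟩)
      i hi u hu hord
    obtain ⟨y, hPy, hyord, hyav⟩ := h
    exact ⟨y, hPy, hyord, by rwa [sup_bot_eq] at hyav⟩
  · -- even depth `2m+2`: sign `−w(E)`, seed `⟨δ(P₀)⟩ = ⟨c_L(1)⟩`
    have h := avoidance_of_kolyvaginSupply_intrinsic_of_double W Dt β ι τ L hρ2 hIQ h3 hodd hHe hT h37 hτ (-W.rootNumber) hL1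
      (hMr (2 * m + 1)) (hMrL (2 * m + 1)) (zmultiples (kummerMapTorsion (W.baseChange K) ((2 ^ L : ℕ) : ℤ) hdiv P₀))
      (fun i u hi hu ↦ by
        obtain ⟨n, hn', hKol, d, hsub, hordc, hsign, hdisj⟩ := hEven m hlt i u hi hu
        exact ⟨n, hn', hKol, d, hsub, hordc, hsign, by rwa [hc1] at hdisj⟩)
      i hi u hu hord
    exact h

end Summit.BirchSwinnertonDyer.BirchSwinnertonDyer.Theorems.KolyvaginGenusTwo

end
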